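/-
Copyright (c) 2026 the pub-hodgecm-mathlib formalisation cell (harness21).  Prover seat hodgecm-mathlib-K2E1-p11 (g5), Track B ∕ K2-LIT, h413 = `stmt-HodgeConjecture-24833`,
R90-TF section S8 «ContSpec-n½», the `hsrc` supplier estate, CORE PIECE (3)(iii) «CHARACTER FACTORISATION» (S8 dealer R90-CS-plan (g3), S8-R222 (3)(iii) ∕ S8-R224 (1); census R90 bus
2026-09-05T02:44:45Z): the Borel character `θ(b) = χ₁(b₀₀)·χ₂(b₁₁)` of the single-character witness block (`χ₂ = 1`) read on an ASSEMBLED finite-adelic Borel element is the PRODUCT OVER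
THE PLACES OF `L⁺` of the local characters of `χ₁` at the local `(0,0)`-entries — i.e. the finite-idele Euler factorisation of a Hecke character, proved here from the tree's modules of definition.
-/
import Literature.NumberTheory.GaloisRepresentations.ArtinReciprocityCharacterProofs              -- ★ `HeckeCharacter.IsModulus.of_isUnramifiedAt`
import Literature.NumberTheory.GaloisRepresentations.AlgebraicHeckeCharacterGrossencharakterProofs  -- ★ `HeckeCharacter.exists_isModulus`
import Literature.NumberTheory.GaloisRepresentations.HeckeCharacterCofiniteProofs                   -- ★ `HeckeCharacter.isUnramifiedAt_cofinite_holds`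
import Literature.NumberTheory.GaloisRepresentations.HeckeCharacterDictionary                       -- ★ `HeckeCharacter.IsUnramifiedAt.coe_map_localUnits_eq_zpow`
import Literature.NumberTheory.Rogawski1990.ExplicitFactorGlobalReciprocity                         -- ★ `finprod_eq_finprod_prod_placesOver` (regrouping along `L ∕ L⁺`)
import Summits.HodgeConjecture.HodgeConjecture.Theorems.K2E1CharacterEisensteinU3PairDefs           -- ★ `firstEntryUnit`, `middleEntryUnitary`, the `U(2,1)` adelic Borel vocabulary
import HarnessLib

/-!
# h413 ∕ R90-S8 — `K2E1ChiBorelCharacterLocalFactorisationU3`: (3)(iii) CHARACTER FACTORISATION — `χ(z) = ∏_v χ_v(z_v)` ON FINITE IDELES, REGROUPED ALONG `L ∕ L⁺`, READ ON THE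
# ASSEMBLED BOREL ELEMENT OF `U(2,1)`

Cell `pub/hodgecm-mathlib`, crux H413 = `stmt-HodgeConjecture-24833`, route `HCCMUnconditional`; R90-TF section S8 «ContSpec-n½», the `hsrc` SUPPLIER ESTATE (★ head p864589
`K2E1ChiMidBlockUnfoldingAtBasePointU3`, R90-CS-p03 (g3); census `R90/S8/CENSUS-UnfoldingAtBasePoint.R90-CS-p03-g3.md` §3: the L core is the PURE-TENSOR READING `hfac`∕`hΩ` of the finite
witness section — (3)(i) `finPart` plumbing (CS-p03), (3)(ii) local–global Borel bridge (K2E1-p14), (3)(iii) character factorisation (this file)).  THEOREMS ONLY (no `def`, no `instance`, no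
`notation`, no named-fact hypothesis, no `sorry`; default heartbeats); lane `--supports stmt-HodgeConjecture-24833 --as helper` (count-neutral).  Closes no socket.

THE MATHEMATICS ([TateThesis1967, §3.2 (quasi-characters of restricted direct products), §4.3]; [NeukirchANT1999, VII §6 (6.10)–(6.12)]; [CasselsFrohlichANT1967, Ch. VII §4]).  A Hecke
character `χ` of a number field `K` has a module of definition (★ `exists_isModulus`: `χ` kills the ideles `y` with `y_∞ = 1`, all `y_v ∈ 𝒪_vˣ`, `y_v ≡ 1 mod 𝔭_v^{e_v}` on a finite `T`),
which may be moved onto any finite `S` containing the ramified places (★ `IsModulus.of_isUnramifiedAt`).  For an idele `z` with `z_∞ = 1` and `S ⊇` {ramified places} ∪ {`v : z_v ∉ 𝒪_vˣ`},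
write `z = y·∏_{v ∈ S} ⟨z_v⟩_v` with `y_∞ = 1`, `y_v = 1` on `S`, `y_v = z_v ∈ 𝒪_vˣ` off `S`: the modulus kills `y`, so **`χ(z) = ∏_{v ∈ S} χ_v(z_v) = ∏ᶠ_v χ_v(z_v)`** (`χ_v = χ ∘ ⟨·⟩_v` the
local component ★ `localComponent`; off `S` the factors are `1` by ★ `IsUnramifiedAt.map_localUnits_eq_one`).  For the CM pair `L ∕ L⁺` the product regroups along the places `v` of `L⁺`
(★ `finprod_eq_finprod_prod_placesOver`), and at a place `v` where `χ` is unramified above `v` the block `∏_{w ∣ v} χ_w(z_w)` is `∏_{w ∣ v} χ(ϖ_w)^{m_w}` (`|z_w|_w = q_w^{−m_w}`, ★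
`IsUnramifiedAt.coe_map_localUnits_eq_zpow`) — the currency of the good-place tokens `hin`∕`hsp` of ★ p864589.  Finally, for a finite-adelic element `b_f` of `U(2,1)(𝔸_{L⁺,f})` whose
image `ι_f(b_f)` lies in `B(𝔸)`, the idele `(ι_f b_f)₀₀ = firstEntryUnit` has archimedean part `1` (★ `GLn.coe_ofFinite_apply`), so the Borel character of the SINGLE-CHARACTER witness
block (`χ₂ = 1`: ★ (E-supp) p864219's `θ(b) = χ₁(b₀₀)·χ₂(b₁₁)`) reads `θ(ι_f b_f) = ∏ᶠ_v ∏_{w ∣ v} χ₁,w(((b_f)₀₀)_w)` — the product over the places of `L⁺` of local characters at the local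
`(0,0)`-entries, which (3)(ii) identifies with the local Iwasawa data of the big-cell element.
* §1 (any number field `K`) **`heckeCharacter_apply_eq_prod_localComponent_of_fst_eq_one`**, **`heckeCharacter_finite_mulSupport_localComponent_finComp`**,
  **`heckeCharacter_apply_eq_finprod_localComponent_of_fst_eq_one`**.
* §2 (CM `L ∕ L⁺`) **`heckeCharacter_apply_eq_finprod_prod_placesOver_of_fst_eq_one`**, **`heckeCharacter_finite_mulSupport_prod_placesOver_localComponent`**,
  **`heckeCharacter_prod_placesOver_localComponent_eq_of_isUnramifiedAt`** (good-place reading).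
* §3 (`U(2,1)_{L∕L⁺}`) **`fst_firstEntryUnit_finAdelicToAdelic`**, **`finComp_firstEntryUnit_finAdelicToAdelic`**, HEAD **`borelCharacter_finAdelicToAdelic_eq_finprod`**, and its
  PRESCRIBED-COMPONENTS form **`borelCharacter_finAdelicToAdelic_eq_finprod_of_apply_eq`** (the local `(0,0)`-entries given as local units `zloc w` — ★ K2E1-p14's (3)(ii) §4 supplies them).
HONEST LABEL: HC_CM is proved only modulo the 7 printed citations (2 remaining named inputs: hLiu418 = `stmt-HodgeConjecture-24832`, h413 = `stmt-HodgeConjecture-24833`) until rung 0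
closes; REL ≠ ★ ≠ BUILT; unconditional, asserts no named fact, closes no socket; `hsrc` = ★ head modulo {(3)(i), (3)(ii), `hfin`} after this; count-neutral.

## References
* [TateThesis1967] J. Tate, *Fourier analysis in number fields and Hecke's zeta-functions*, in Cassels–Fröhlich (1967), §3.2 (Lemma 3.2.1), §4.3.
* [NeukirchANT1999] J. Neukirch, *Algebraic Number Theory* (1999), Ch. VII §6, (6.10)–(6.12).
* [CasselsFrohlichANT1967] J. W. S. Cassels, A. Fröhlich (eds.), *Algebraic Number Theory* (1967), Ch. VII (Tate) §4.
* [Rogawski1990] J. D. Rogawski, *Automorphic Representations of Unitary Groups in Three Variables* (1990), §1.10 p. 9, §4.2.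
-/

set_option autoImplicit false
set_option linter.dupNamespace false  -- the mandated namespace repeats the summit's segment (`HodgeConjecture.HodgeConjecture`)

noncomputable section

open NumberField IsDedekindDomain Filter Set Function
open Literature.NumberTheory.GaloisRepresentations Literature.NumberTheory.GaloisRepresentations.HeckeCharacter
open Literature.NumberTheory.Automorphic Literature.NumberTheory.Automorphic.UnitaryGroup AdelicGroupData
open Literature.NumberTheory.Automorphic.Arthur2013.Leaves.TECR
open Summit.HodgeConjecture.HodgeConjecture.Cruxes.H413.K2E1CharacterEisensteinU2Defs
open Summit.HodgeConjecture.HodgeConjecture.Cruxes.H413.K2E1CharacterEisensteinU3PairDefs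

namespace Summit.HodgeConjecture.HodgeConjecture.Cruxes.H413.K2E1ChiBorelCharacterLocalFactorisationU3

/-! ## §1 Any number field: `χ(z) = ∏_v χ_v(z_v)` on the finite ideles -/

section NumberField

variable {K : Type*} [Field K] [NumberField K]

/-- **THE HECKE CHARACTER OF A FINITE IDELE IS THE PRODUCT OF ITS LOCAL COMPONENTS OVER ANY LARGE ENOUGH FINITE SET OF PLACES**: if `z_∞ = 1` and `S` contains every place where `χ`
ramifies or `z_v` is not a unit, then `χ(z) = ∏_{v ∈ S} χ_v(z_v)` — the module of definition of `χ` moved onto `S` kills `z·(∏_{v∈S} ⟨z_v⟩_v)⁻¹`.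
[cite: TateThesis1967, §3.2 Lemma 3.2.1, §4.3] [cite: NeukirchANT1999, Ch. VII §6 (6.11)–(6.12)] -/
theorem heckeCharacter_apply_eq_prod_localComponent_of_fst_eq_one (χ : HeckeCharacter K) (z : ideleGroup K)
    (hz : (z : AdeleRing (𝓞 K) K).1 = 1) (S : Finset (HeightOneSpectrum (𝓞 K)))
    (hS : ∀ v ∉ S, χ.IsUnramifiedAt v ∧ Valued.v ((z : AdeleRing (𝓞 K) K).2 v) = 1) :
    χ z = ∏ v ∈ S, χ.localComponent v ((ideleGroup.finComp v).toHomUnits z) := by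
  classical
  obtain ⟨T, e, hmod⟩ := χ.exists_isModulus
  have hmodS : IsModulus χ S e := hmod.of_isUnramifiedAt fun v _ hvS => (hS v hvS).1
  set u : ∀ v : HeightOneSpectrum (𝓞 K), (v.adicCompletion K)ˣ := fun v => (ideleGroup.finComp v).toHomUnits z with hu
  have hu_val : ∀ v : HeightOneSpectrum (𝓞 K), ((u v : (v.adicCompletion K)ˣ) : v.adicCompletion K) = (z : AdeleRing (𝓞 K) K).2 v := fun v => rfl
  -- the module of definition on `S` kills `y := z · (∏_{v ∈ S} ⟨z_v⟩_v)⁻¹`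
  have hχy : χ (z * (∏ v ∈ S, localUnits v (u v))⁻¹) = 1 := by
    refine hmodS _ ?_ (fun w => ?_) (fun w hw => ?_)
    · have h2 : (((∏ v ∈ S, localUnits v (u v))⁻¹ : ideleGroup K) : AdeleRing (𝓞 K) K).1 = 1 := by
        have := ideleGroup_val_inv_fst_mul (∏ v ∈ S, localUnits v (u v))
        rwa [fst_prod_localUnits, mul_one] at this
      rw [ideleGroup_val_fst_mul, hz, h2, mul_one]
    · rw [ideleGroup_val_snd_mul, ideleGroup_val_inv_snd, snd_prod_localUnits]
      split_ifs with hwS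
      · rw [hu_val, mul_inv_cancel₀ (ideleGroup_snd_ne_zero z w), map_one]
      · rw [inv_one, mul_one]
        exact (hS w hwS).2
    · rw [ideleGroup_val_snd_mul, ideleGroup_val_inv_snd, snd_prod_localUnits, if_pos hw, hu_val, mul_inv_cancel₀ (ideleGroup_snd_ne_zero z w), sub_self,
        map_zero]
      exact zero_le
  have key : χ z = χ (z * (∏ v ∈ S, localUnits v (u v))⁻¹) * χ (∏ v ∈ S, localUnits v (u v)) := by rw [← map_mul, inv_mul_cancel_right]
  rw [key, hχy, one_mul, map_prod]
  exact Finset.prod_congr rfl fun v _ => (localComponent_apply χ v (u v)).symm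

/-- **ALMOST ALL LOCAL FACTORS ARE `1`**: `v ↦ χ_v(z_v)` has finite multiplicative support (off the finite set of places where `χ` ramifies or `z_v ∉ 𝒪_vˣ`, `χ_v(z_v) = 1` — ★
`isUnramifiedAt_cofinite_holds`, ★ `ideleGroup_valued_snd_eventually_eq_one`, ★ `IsUnramifiedAt.map_localUnits_eq_one`). [cite: TateThesis1967, §3.2 Lemma 3.2.1] -/
theorem heckeCharacter_finite_mulSupport_localComponent_finComp (χ : HeckeCharacter K) (z : ideleGroup K) :
    (mulSupport fun v : HeightOneSpectrum (𝓞 K) => χ.localComponent v ((ideleGroup.finComp v).toHomUnits z)).Finite := by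
  refine (Filter.eventually_cofinite.1 ((isUnramifiedAt_cofinite_holds χ).and (ideleGroup_valued_snd_eventually_eq_one z))).subset fun v hv => ?_
  intro h
  exact hv (show χ.localComponent v ((ideleGroup.finComp v).toHomUnits z) = 1 by rw [localComponent_apply]; exact h.1.map_localUnits_eq_one _ h.2)

/-- **`χ(z) = ∏ᶠ_v χ_v(z_v)` FOR A FINITE IDELE** (`z_∞ = 1`): the finitely supported product of the local components (§1 at `S :=` the exceptional places). [cite: TateThesis1967, §3.2 Lemma 3.2.1, §4.3] [cite: NeukirchANT1999, Ch. VII §6 (6.12)] -/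
theorem heckeCharacter_apply_eq_finprod_localComponent_of_fst_eq_one (χ : HeckeCharacter K) (z : ideleGroup K)
    (hz : (z : AdeleRing (𝓞 K) K).1 = 1) :
    χ z = ∏ᶠ v : HeightOneSpectrum (𝓞 K), χ.localComponent v ((ideleGroup.finComp v).toHomUnits z) := by
  classical
  have hfin : {v : HeightOneSpectrum (𝓞 K) | ¬ (χ.IsUnramifiedAt v ∧ Valued.v ((z : AdeleRing (𝓞 K) K).2 v) = 1)}.Finite :=
    Filter.eventually_cofinite.1 ((isUnramifiedAt_cofinite_holds χ).and (ideleGroup_valued_snd_eventually_eq_one z))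
  have hS : ∀ v ∉ hfin.toFinset, χ.IsUnramifiedAt v ∧ Valued.v ((z : AdeleRing (𝓞 K) K).2 v) = 1 := fun v hv => by
    by_contra h
    exact hv (hfin.mem_toFinset.2 h)
  rw [heckeCharacter_apply_eq_prod_localComponent_of_fst_eq_one χ z hz hfin.toFinset hS, finprod_eq_prod_of_mulSupport_subset]
  intro v hv
  by_contra hvS
  have h := hS v fun h => hvS (Finset.mem_coe.2 h)
  exact hv (show χ.localComponent v ((ideleGroup.finComp v).toHomUnits z) = 1 by rw [localComponent_apply]; exact h.1.map_localUnits_eq_one _ h.2)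

end NumberField

/-! ## §2 The CM pair `L ∕ L⁺`: regrouping along the places of `L⁺`, and the good-place reading -/

section CM

variable (L : Type) [Field L] [NumberField L] [IsCMField L]

omit [IsCMField L] in
/-- **`χ(z) = ∏ᶠ_{v ∤ ∞ of L⁺} ∏_{w ∣ v} χ_w(z_w)` FOR A FINITE IDELE OF THE CM FIELD `L`** — §1 regrouped along `L ∕ L⁺` (★ `finprod_eq_finprod_prod_placesOver`).
[cite: TateThesis1967, §4.3] [cite: CasselsFrohlichANT1967, Ch. II §11] -/
theorem heckeCharacter_apply_eq_finprod_prod_placesOver_of_fst_eq_one (χ : HeckeCharacter L) (z : ideleGroup L)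
    (hz : (z : AdeleRing (𝓞 L) L).1 = 1) :
    χ z = ∏ᶠ v : HeightOneSpectrum (𝓞 ↥(maximalRealSubfield L)), ∏ w : PlacesOver L v, χ.localComponent w.1 ((ideleGroup.finComp w.1).toHomUnits z) := by
  rw [heckeCharacter_apply_eq_finprod_localComponent_of_fst_eq_one χ z hz]
  exact Literature.NumberTheory.Rogawski1990.finprod_eq_finprod_prod_placesOver (↥(maximalRealSubfield L))
    (fun w : HeightOneSpectrum (𝓞 L) => χ.localComponent w ((ideleGroup.finComp w).toHomUnits z)) (heckeCharacter_finite_mulSupport_localComponent_finComp χ z)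

omit [IsCMField L] in
/-- The regrouped factors `v ↦ ∏_{w ∣ v} χ_w(z_w)` have finite multiplicative support (a block is `≠ 1` only if some factor above `v` is). [cite: TateThesis1967, §3.2 Lemma 3.2.1] -/
theorem heckeCharacter_finite_mulSupport_prod_placesOver_localComponent (χ : HeckeCharacter L) (z : ideleGroup L) :
    (mulSupport fun v : HeightOneSpectrum (𝓞 ↥(maximalRealSubfield L)) => ∏ w : PlacesOver L v, χ.localComponent w.1 ((ideleGroup.finComp w.1).toHomUnits z)).Finite := by
  classical
  refine ((heckeCharacter_finite_mulSupport_localComponent_finComp χ z).image fun w : HeightOneSpectrum (𝓞 L) => w.under (𝓞 ↥(maximalRealSubfield L))).subset fun v hv => ?_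
  by_contra hv'
  refine hv (Finset.prod_eq_one fun w _ => ?_)
  by_contra hw
  exact hv' ⟨w.1, hw, w.2⟩

omit [IsCMField L] in
/-- **THE GOOD-PLACE READING**: at a place `v` of `L⁺` above which `χ` is unramified, the block `∏_{w ∣ v} χ_w(z_w)` of the factorisation is `∏_{w ∣ v} χ(ϖ_w)^{m_w}` where `|z_w|_w = q_w^{−m_w}`
(★ `IsUnramifiedAt.coe_map_localUnits_eq_zpow`) — the currency of the unramified tokens. [cite: TateThesis1967, §2.5] [cite: NeukirchANT1999, Ch. VII §6 (6.12)] -/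
theorem heckeCharacter_prod_placesOver_localComponent_eq_of_isUnramifiedAt (χ : HeckeCharacter L) (z : ideleGroup L)
    {v : HeightOneSpectrum (𝓞 ↥(maximalRealSubfield L))} (hunr : ∀ w : PlacesOver L v, χ.IsUnramifiedAt w.1)
    (m : PlacesOver L v → ℤ) (hm : ∀ w : PlacesOver L v, Valued.v ((z : AdeleRing (𝓞 L) L).2 w.1) = WithZero.exp (-(m w))) :
    ∏ w : PlacesOver L v, ((χ.localComponent w.1 ((ideleGroup.finComp w.1).toHomUnits z) : ℂˣ) : ℂ) = ∏ w : PlacesOver L v, χ.valueAtUniformizer w.1 ^ m w :=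
  Finset.prod_congr rfl fun w _ => by
    rw [localComponent_apply]
    exact (hunr w).coe_map_localUnits_eq_zpow _ (hm w)

/-! ## §3 `U(2,1)_{L ∕ L⁺}`: the Borel character of the single-character block on an assembled finite-adelic Borel element -/

/-- The idele `(ι_f b_f)₀₀` of a finite-adelic element embedded in `U(2,1)(𝔸)` has archimedean part `1` (★ `GLn.coe_ofFinite_apply`). [cite: Rogawski1990, §1.10 p. 9] -/
theorem fst_firstEntryUnit_finAdelicToAdelic (b : ↥(finAdelic (↥(maximalRealSubfield L)) L (IsCMField.complexConj L) 3 ((StdForm.antidiagonal 3).over L)))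
    (hb : finAdelicToAdelic (↥(maximalRealSubfield L)) L (IsCMField.complexConj L) 3 ((StdForm.antidiagonal 3).over L) b ∈ borelAdelic (↥(maximalRealSubfield L)) L (IsCMField.complexConj L) 3) :
    ((firstEntryUnit hb : ideleGroup L) : AdeleRing (𝓞 L) L).1 = 1 := by
  rw [coe_firstEntryUnit, adelicVal_finAdelicToAdelic, GLn.coe_ofFinite_apply, Matrix.one_apply_eq]

/-- The local component at `w` of the idele `(ι_f b_f)₀₀` is the `w`-component of the finite adele `(b_f)₀₀` (★ `GLn.coe_ofFinite_apply`). [cite: Rogawski1990, §1.10 p. 9] -/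
theorem finComp_firstEntryUnit_finAdelicToAdelic (b : ↥(finAdelic (↥(maximalRealSubfield L)) L (IsCMField.complexConj L) 3 ((StdForm.antidiagonal 3).over L)))
    (hb : finAdelicToAdelic (↥(maximalRealSubfield L)) L (IsCMField.complexConj L) 3 ((StdForm.antidiagonal 3).over L) b ∈ borelAdelic (↥(maximalRealSubfield L)) L (IsCMField.complexConj L) 3)
    (w : HeightOneSpectrum (𝓞 L)) :
    ideleGroup.finComp w (firstEntryUnit hb) = (((b : GL (Fin 3) (FiniteAdeleRing (𝓞 L) L)) : Matrix (Fin 3) (Fin 3) (FiniteAdeleRing (𝓞 L) L)) 0 0) w := by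
  rw [ideleGroup.finComp_apply, coe_firstEntryUnit, adelicVal_finAdelicToAdelic, GLn.coe_ofFinite_apply]

/-- **(3)(iii) — THE BOREL CHARACTER OF THE SINGLE-CHARACTER BLOCK ON AN ASSEMBLED FINITE BOREL ELEMENT IS THE PRODUCT OVER THE PLACES OF `L⁺` OF THE LOCAL CHARACTERS AT THE LOCAL
`(0,0)`-ENTRIES** (HEAD): for `b_f ∈ U(2,1)(𝔸_{L⁺,f})` with `ι_f(b_f) ∈ B(𝔸)`, the Borel character of ★ (E-supp)'s witness section of the block `(χ₁, 1)`,
`θ(ι_f b_f) = χ₁((ι_f b_f)₀₀)·𝟙((ι_f b_f)₁₁)`, equals `∏ᶠ_{v ∤ ∞} ∏_{w ∣ v} χ₁,w(((b_f)₀₀)_w)` — §2 at the idele `(ι_f b_f)₀₀` (archimedean part `1`).  With (3)(ii) (the local `(0,0)`-entries are the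
local Iwasawa data) this is the `hΩ`-reading's character factor. [cite: TateThesis1967, §4.3] [cite: Rogawski1990, §1.10 p. 9, §4.2] -/
theorem borelCharacter_finAdelicToAdelic_eq_finprod (χ₁ : HeckeCharacter L) (b : ↥(finAdelic (↥(maximalRealSubfield L)) L (IsCMField.complexConj L) 3 ((StdForm.antidiagonal 3).over L)))
    (hb : finAdelicToAdelic (↥(maximalRealSubfield L)) L (IsCMField.complexConj L) 3 ((StdForm.antidiagonal 3).over L) b ∈ borelAdelic (↥(maximalRealSubfield L)) L (IsCMField.complexConj L) 3) :
    ((χ₁ (firstEntryUnit hb) : ℂˣ) : ℂ) * (((1 : ↥(TorusDict.torus (IsCMField.complexConj L)) →ₜ* ℂˣ) (middleEntryUnitary hb) : ℂˣ) : ℂ) =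
      ∏ᶠ v : HeightOneSpectrum (𝓞 ↥(maximalRealSubfield L)), ∏ w : PlacesOver L v,
        ((χ₁.localComponent w.1 ((ideleGroup.finComp w.1).toHomUnits (firstEntryUnit hb)) : ℂˣ) : ℂ) := by
  have h1 : ((1 : ↥(TorusDict.torus (IsCMField.complexConj L)) →ₜ* ℂˣ) (middleEntryUnitary hb) : ℂˣ) = 1 := rfl
  rw [h1, Units.val_one, mul_one, heckeCharacter_apply_eq_finprod_prod_placesOver_of_fst_eq_one L χ₁ _ (fst_firstEntryUnit_finAdelicToAdelic L b hb), ← Units.coeHom_apply,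
    MonoidHom.map_finprod _ (heckeCharacter_finite_mulSupport_prod_placesOver_localComponent L χ₁ _)]
  simp only [map_prod, Units.coeHom_apply]

/-- **PRESCRIBED-COMPONENTS FORM** (for ★ K2E1-p14's (3)(ii) `exists_borel_mul_level_evalPlace_eq`, whose global Borel factor READS the chosen local Iwasawa data): if the local
`(0,0)`-entries of `b_f` are the given local units `zloc w` (`((b_f)₀₀)_w = zloc w`), then `θ(ι_f b_f) = ∏ᶠ_v ∏_{w ∣ v} χ₁,w(zloc w)`. [cite: TateThesis1967, §4.3] [cite: Rogawski1990, §1.10 p. 9, §4.2] -/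
theorem borelCharacter_finAdelicToAdelic_eq_finprod_of_apply_eq (χ₁ : HeckeCharacter L) (b : ↥(finAdelic (↥(maximalRealSubfield L)) L (IsCMField.complexConj L) 3 ((StdForm.antidiagonal 3).over L)))
    (hb : finAdelicToAdelic (↥(maximalRealSubfield L)) L (IsCMField.complexConj L) 3 ((StdForm.antidiagonal 3).over L) b ∈ borelAdelic (↥(maximalRealSubfield L)) L (IsCMField.complexConj L) 3)
    (zloc : ∀ w : HeightOneSpectrum (𝓞 L), (w.adicCompletion L)ˣ)
    (hz : ∀ w : HeightOneSpectrum (𝓞 L), (((b : GL (Fin 3) (FiniteAdeleRing (𝓞 L) L)) : Matrix (Fin 3) (Fin 3) (FiniteAdeleRing (𝓞 L) L)) 0 0) w = (zloc w : w.adicCompletion L)) :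
    ((χ₁ (firstEntryUnit hb) : ℂˣ) : ℂ) * (((1 : ↥(TorusDict.torus (IsCMField.complexConj L)) →ₜ* ℂˣ) (middleEntryUnitary hb) : ℂˣ) : ℂ) =
      ∏ᶠ v : HeightOneSpectrum (𝓞 ↥(maximalRealSubfield L)), ∏ w : PlacesOver L v, ((χ₁.localComponent w.1 (zloc w.1) : ℂˣ) : ℂ) := by
  have hloc : ∀ w : HeightOneSpectrum (𝓞 L), (ideleGroup.finComp w).toHomUnits (firstEntryUnit hb) = zloc w := fun w =>
    Units.ext (by rw [MonoidHom.coe_toHomUnits, finComp_firstEntryUnit_finAdelicToAdelic, hz])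
  rw [borelCharacter_finAdelicToAdelic_eq_finprod L χ₁ b hb]
  exact finprod_congr fun v => Finset.prod_congr rfl fun w _ => by rw [hloc]

end CM

end Summit.HodgeConjecture.HodgeConjecture.Cruxes.H413.K2E1ChiBorelCharacterLocalFactorisationU3

end
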